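import Summits.FinalStateConjecture.FinalStateConjecture.Theses.BartnikGapSettling
import Literature.Geometry.Lorentzian.BoundedGeometry

/-!
# Repaired signature for crux `BondiBartnikRigidity` (stmt-FinalStateConjecture-10807) — planner-ready

NOT a proposal (statement items are the planner's, D-0019); this file only shows that the minimal repaired
statement C″ ELABORATES and is a WEAKENING of the filed decl (`repaired_of_filed`).  Three edits to the filed text:

1. `∀ Λ : ENNReal, Λ < 1 →` in place of `Λ < ⊤` (Defect A: for `Λ > ‖η‖ₑ = 1` the flat-chart clause
   `deviationCk (hypBackground U₀) Ψ₀ k' 0 ≤ Λ` of `IsNearKerrLeaf` is met by COLLAPSED charts — `Ψ₀^* g → 0` in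
   `C^{k'}` gives deviation `→ −η`, norm `1` — so the hypothesis leaf certifies nothing off the hole slabs; with such a
   junk leaf the `N = 0` sector is defeated by a swarm of just-visible high-frequency pulses of total energy `< γ/2`);
   `Λ ≤ 1/2` is the safer normalisation (at `Λ → 1⁻` the certified physical scale of the hyperboloid shrinks like
   `√(1 − Λ)` by the zoom-out `Ψ₀(x) = F(√c · x)`).
2. `N ≤ 1` (Defect B: for two causally unrelated core components the achronal boundary `∂J⁺(C)` has a seam reaching
   `𝓘⁺`; sections of a `RoundSectionFamily` avoid it, are pinned on one component's cone, hence unboundedly boosted,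
   and their Hawking masses diverge: `∃ m, HasCutBondiMass C m` fails, the sector is vacuous; and Defect C: for
   `ε ≪ M` the CONCLUSION `IsNearKerrLeaf k ε N M a S'` with `N ≥ 2` is met only by ultra-boosted charts of holes
   separated by `≳ M ε^{-(k+5)/3}`, never by a binary).
3. `N = 0 ∨ ∃ i, p ∈ Φ i '' (collar slab i)` (Defect B again: for `N = 1` with `p` off the collar the core
   `{p} ∪ collar` is seamed and the hypothesis is vacuous; with `p` in the collar the core IS the collar).

Everything else is byte-identical to the filed term (Theses/BartnikGapSettling.lean, rev 2, l.363–364).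
-/

noncomputable section

-- D-0017: single-problem summit, `Summit.<S>.<S>.…` by design (cf. lakefile `weak.linter.dupNamespace`).
set_option linter.dupNamespace false

open Set Filter Function Topology TopologicalSpace
open scoped Manifold ContDiff Topology ENNReal BigOperators

namespace Summit.FinalStateConjecture.FinalStateConjecture.Cruxes.BondiBartnikRigidity

/-- **Repaired crux C″** (minimal repair of `BondiBartnikRigidity`, stmt-FinalStateConjecture-10807): the filed
statement with `Λ < 1`, `N ≤ 1`, and `p` in a collar slab when `N = 1`.  See the module docstring. -/
def BondiBartnikRigidityRepaired : Prop :=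
  open Literature.Geometry.Lorentzian in ∀ (χ m₀ : ℝ) (N₀ k : ℕ) (ε : ENNReal), χ < 1 → 0 < m₀ → 0 < ε → ∃ k' : ℕ, ∀ Λ : ENNReal, Λ < 1 → ∃ (δ : ENNReal) (γ : ℝ), 0 < δ ∧ 0 < γ ∧ ∀ (X : Type) [TopologicalSpace X] [ChartedSpace E3 X] [IsManifold (𝓡 3) ((⊤ : ℕ∞) : WithTop ℕ∞) X] [T2Space X] [SecondCountableTopology X] [ConnectedSpace X], ∀ D ∈ admissibleVacuumData X, ∀ (𝒟 : VacuumCauchyDevelopment D) (N : ℕ) (M a : Fin N → ℝ) (S : Set 𝒟.carrier) (p : 𝒟.carrier) (mo' : Fin N → lorentzGroup × E4) (B' : Fin N → ModelBackground) (Φ : ∀ i, (B' i).domain → 𝒟.carrier), 𝒟.IsMaximal → N ≤ N₀ → N ≤ 1 → (∀ i, m₀ ≤ M i ∧ M i ≤ m₀⁻¹ ∧ |a i| ≤ χ * M i) → 𝒟.toCauchyDevelopment.IsNearKerrLeaf k' Λ N M a S → p ∈ S → (N = 0 ∨ ∃ i, p ∈ Φ i '' (B' i).truncTimeSlab (3 *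 M i) 0) → (∀ i, B' i = starBackground (mo' i).1 (mo' i).2 (M i) (a i) (fun x => Kerr.radius (a i) (poincareInv (mo' i).1 (mo' i).2 x))) → (∀ i, ContMDiffOn 𝓘(ℝ, E4) (𝓡 4) ((⊤ : ℕ∞) : WithTop ℕ∞) (Φ i) {x | -1 < (B' i).time x.1 ∧ (B' i).time x.1 < 1 ∧ (B' i).radius x.1 < 3 * M i + 1} ∧ Topology.IsOpenEmbedding ({x | -1 < (B' i).time x.1 ∧ (B' i).time x.1 < 1 ∧ (B' i).radius x.1 < 3 * M i + 1}.restrict (Φ i))) → (∀ i, 𝒟.toSpacetime.truncDeviationCk (B' i) (Φ i) k' (3 * M i) 0 ≤ δ) → (∀ i, Φ i '' (B' i).truncTimeSlab (3 * M i) 0 ⊆ S) → Pairwise (Function.onFun Disjoint fun i => Φ i '' (B' i).truncTimeSlab (3 * M i) 0) → (∃ m : ℝ, 𝒟.toCauchyDevelopment.HasCutBondiMass ({p} ∪ ⋃ i, Φ i '' (B' i).truncTimeSlab (3 * M i) 0) m) → (∀ (X' : Type) [TopologicalSpace X'] [ChartedSpace E3 X'] [IsManifold (𝓡 3) ((⊤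 : ℕ∞) : WithTop ℕ∞) X'] [T2Space X'] [SecondCountableTopology X'] [ConnectedSpace X'], ∀ D' ∈ admissibleVacuumData X', ∀ (𝒟' : VacuumCauchyDevelopment D') (U : Set 𝒟.carrier) (φ : 𝒟.carrier → 𝒟'.carrier) (m' : ℝ), 𝒟'.IsMaximal → IsOpen U → ({p} ∪ ⋃ i, Φ i '' (B' i).truncTimeSlab (3 * M i) 0) ⊆ U → ContMDiffOn (𝓡 4) (𝓡 4) ((⊤ : ℕ∞) : WithTop ℕ∞) φ U → Topology.IsOpenEmbedding (U.restrict φ) → (∀ q ∈ U, pullbackBilin (I := 𝓡 4) (I' := 𝓡 4) φ 𝒟'.metric.val q = 𝒟.metric.val q) → (∀ q ∈ U, 𝒟'.timeOrientation.IsFutureDirected (mfderiv (𝓡 4) (𝓡 4) φ q (𝒟.timeOrientation.vectorField q))) → 𝒟'.toCauchyDevelopment.HasCutBondiMass (φ '' ({p} ∪ ⋃ i, Φ i '' (B' i).truncTimeSlab (3 * M i) 0)) m' → ∀ η : ℝ, 0 < η → ∃ m : ℝ, 𝒟.toCauchyDevelopment.HasCutBondiMass ({p} ∪ ⋃ i,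 Φ i '' (B' i).truncTimeSlab (3 * M i) 0) m ∧ m ≤ m' + γ + η) → ∃ S' : Set 𝒟.carrier, 𝒟.toCauchyDevelopment.IsNearKerrLeaf k ε N M a S' ∧ S' ⊆ 𝒟.metric.causalFuture 𝒟.timeOrientation S

/-- The repaired statement is a WEAKENING of the filed one (sanity: the repair adds hypotheses and shrinks the
range of `Λ`; it proves nothing about either). -/
theorem repaired_of_filed
    (h : Summit.FinalStateConjecture.FinalStateConjecture.Theses.BartnikGapSettling.BondiBartnikRigidity) :
    BondiBartnikRigidityRepaired := by
  intro χ m₀ N₀ k ε hχ hm₀ hε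
  obtain ⟨k', hk'⟩ := h χ m₀ N₀ k ε hχ hm₀ hε
  refine ⟨k', fun Λ hΛ => ?_⟩
  obtain ⟨δ, γ, hδ, hγ, H⟩ := hk' Λ (hΛ.trans_le le_top)
  refine ⟨δ, γ, hδ, hγ, ?_⟩
  intro X _ _ _ _ _ _ D hD 𝒟 N M a S p mo' B' Φ hmax hN _hN1 hwin hleaf hp _hpc hB hΦ hdev hsub hdis hcut hgap
  exact H X D hD 𝒟 N M a S p mo' B' Φ hmax hN hwin hleaf hp hB hΦ hdev hsub hdis hcut hgap


/-! ## Variant (a): honest bounded geometry with a LARGE tolerance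

`IsNearKerrLeafBG 𝒟 k ε Λ₁ N M a S` is the body of `CauchyDevelopment.IsNearKerrLeaf` VERBATIM (NearKerrLeaf.lean
l.305–332) with ONE clause appended: the FLAT chart has bounded chart geometry with constant `Λ₁` on its slab
(`Spacetime.HasBoundedGeometryOn`, BoundedGeometry.lean l.414: `C²` bound, `g(dΨ₀ ∂₀, dΨ₀ ∂₀) ≤ −Λ₁⁻¹`,
`g(dΨ₀ v, dΨ₀ v) ≥ Λ₁⁻¹‖v‖²` for `v⁰ = 0`). The cone clauses are exactly the normalisation whose absence lets `Λ > 1`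
flat charts collapse (`Literature/Geometry/Lorentzian/DeviationTolerance.lean`); with an honest complete flat end,
`J⁺(S) = D⁺(S)` prices every incoming pulse, which is what the rigidity mechanism needs. The clause is NOT imposed on the
hole charts: the Kerr–Schild `∂_{t*}` is spacelike inside the ergoregion, so the `timelike` field of
`HasBoundedGeometryOn` is unsatisfiable by honest Kerr-star charts on `{M < r < 2M}`; honesty of the near zone beyond the
collar is not needed (the collars carry `(M, a)`; a pulse hidden there is priced when it crossed the flat end). With this
the crux can keep `∀ Λ < ⊤` ("bounded geometry, not smallness") — `BondiBartnikRigidityRepairedBG` below (also with the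
N-sector repairs). A definition request for the planner, not a proposal. -/

section VariantA

open Literature.Geometry.Lorentzian

variable {X : Type} [TopologicalSpace X] [ChartedSpace E3 X] [IsManifold (𝓡 3) ∞ X]
  [ConnectedSpace X] {D : InitialDataSet (𝓡 3) X}

/-- `IsNearKerrLeaf` (verbatim body) + bounded chart geometry of constant `Λ₁` for the flat chart on `{t₀ = 0}`. -/
def IsNearKerrLeafBG (𝒟 : CauchyDevelopment D) (k : ℕ) (ε : ℝ≥0∞) (Λ₁ : ℝ) (N : ℕ) (M a : Fin N → ℝ)
    (S : Set 𝒟.carrier) : Prop :=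
  ∃ (R ρ : Fin N → ℝ) (mo : Fin N → lorentzGroup × E4) (r : Fin N → E4 → ℝ)
    (B : Fin N → ModelBackground) (U₀ : Opens E4) (B₀ : ModelBackground)
    (Ψ : ∀ i, (B i).domain → 𝒟.carrier) (Ψ₀ : B₀.domain → 𝒟.carrier)
    (L W : ∀ i, Set (B i).domain) (L₀ W₀ : Set B₀.domain),
    (∀ i, r i = fun x => Kerr.radius (a i) (poincareInv (mo i).1 (mo i).2 x)) ∧
    (∀ i, B i = starBackground (mo i).1 (mo i).2 (M i) (a i) (r i)) ∧
    B₀ = hypBackground U₀ ∧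
    (∀ i, L i = {x | -1 < (B i).time x.1 ∧ (B i).time x.1 < 1 ∧ (B i).radius x.1 < R i + 1} ∧
      W i = {x | 0 < (B i).time x.1 ∧ (B i).time x.1 < 1 ∧ (B i).radius x.1 ≤ R i}) ∧
    L₀ = {x | -1 < B₀.time x.1 ∧ B₀.time x.1 < 1} ∧
    W₀ = {x | 0 < B₀.time x.1 ∧ B₀.time x.1 < 1} ∧
    (∀ i, 0 < M i ∧ |a i| ≤ M i ∧ 0 < ρ i ∧ ρ i < R i) ∧
    {x : E4 | -1 < x 0 - Real.sqrt (1 + E4.spatialNorm x ^ 2) ∧ ∀ i, ρ i < r i x} ⊆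
      (U₀ : Set E4) ∧
    (∀ i, ContMDiffOn 𝓘(ℝ, E4) (𝓡 4) ∞ (Ψ i) (L i) ∧ IsOpenEmbedding ((L i).restrict (Ψ i)) ∧
      Ψ i '' L i ⊆ 𝒟.metric.causalFuture 𝒟.timeOrientation (range 𝒟.embed)) ∧
    ContMDiffOn 𝓘(ℝ, E4) (𝓡 4) ∞ Ψ₀ L₀ ∧ IsOpenEmbedding (L₀.restrict Ψ₀) ∧
    Ψ₀ '' L₀ ⊆ 𝒟.metric.causalFuture 𝒟.timeOrientation (range 𝒟.embed) ∧
    (∀ i, 𝒟.toSpacetime.truncDeviationCk (B i) (Ψ i) k (R i) 0 ≤ ε) ∧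
    𝒟.toSpacetime.deviationCk B₀ Ψ₀ k 0 ≤ ε ∧
    Pairwise (Function.onFun Disjoint fun i => Ψ i '' {x | x ∈ L i ∧ (B i).radius x.1 ≤ R i}) ∧
    (∀ i, Ψ i '' {x | (B i).time x.1 = 0 ∧ ρ i < (B i).radius x.1 ∧ (B i).radius x.1 ≤ R i} ⊆
      Ψ₀ '' L₀) ∧
    (∀ i, Ψ₀ '' {x | B₀.time x.1 = 0 ∧ ρ i < r i x.1 ∧ r i x.1 < R i} ⊆ Ψ i '' L i) ∧
    S = Ψ₀ '' B₀.timeSlab 0 ∪ ⋃ i, Ψ i '' (B i).truncTimeSlab (R i) 0 ∧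
    Ψ₀ '' W₀ ∪ ⋃ i, Ψ i '' W i ⊆ 𝒟.metric.chronologicalFuture 𝒟.timeOrientation S ∧
    𝒟.exteriorOf (Ψ₀ '' W₀ ∪ ⋃ i, Ψ i '' W i) \ (Ψ₀ '' W₀ ∪ ⋃ i, Ψ i '' W i) ⊆
      𝒟.metric.causalPast 𝒟.timeOrientation S ∧
    𝒟.toSpacetime.HasBoundedGeometryOn B₀ Ψ₀ (B₀.timeSlab 0) Λ₁

/-- The bounded-geometry variant implies the filed leaf predicate (drop the two extra clauses): consumers of
`IsNearKerrLeaf` (e.g. `Capture`) are served by `IsNearKerrLeafBG` leaves unchanged. -/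
theorem IsNearKerrLeafBG.isNearKerrLeaf {𝒟 : CauchyDevelopment D} {k : ℕ} {ε : ℝ≥0∞} {Λ₁ : ℝ} {N : ℕ}
    {M a : Fin N → ℝ} {S : Set 𝒟.carrier} (h : IsNearKerrLeafBG 𝒟 k ε Λ₁ N M a S) :
    𝒟.IsNearKerrLeaf k ε N M a S := by
  obtain ⟨R, ρ, mo, r, B, U₀, B₀, Ψ, Ψ₀, L, W, L₀, W₀, hr, hB, hB₀, hLW, hL₀, hW₀, hpar, hU₀, hΨ, hΨ₀, hΨ₀e, hΨ₀J,
    hdev, hdev₀, hdisj, hov₁, hov₂, hS, hWI, hbar, -⟩ := h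
  exact ⟨R, ρ, mo, r, B, U₀, B₀, Ψ, Ψ₀, L, W, L₀, W₀, hr, hB, hB₀, hLW, hL₀, hW₀, hpar, hU₀, hΨ, hΨ₀, hΨ₀e, hΨ₀J,
    hdev, hdev₀, hdisj, hov₁, hov₂, hS, hWI, hbar⟩

end VariantA

/-- **Repaired crux, variant (a)**: the filed statement with `IsNearKerrLeafBG k' Λ Λ₁` (any `Λ < ⊤`, any real `Λ₁`,
both universally quantified before `δ, γ`) in place of `IsNearKerrLeaf k' Λ`, plus `N ≤ 1` and the `p`-in-collar clause. -/
def BondiBartnikRigidityRepairedBG : Prop :=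
  open Literature.Geometry.Lorentzian in ∀ (χ m₀ : ℝ) (N₀ k : ℕ) (ε : ENNReal), χ < 1 → 0 < m₀ → 0 < ε → ∃ k' : ℕ, ∀ (Λ : ENNReal) (Λ₁ : ℝ), Λ < ⊤ → ∃ (δ : ENNReal) (γ : ℝ), 0 < δ ∧ 0 < γ ∧ ∀ (X : Type) [TopologicalSpace X] [ChartedSpace E3 X] [IsManifold (𝓡 3) ((⊤ : ℕ∞) : WithTop ℕ∞) X] [T2Space X] [SecondCountableTopology X] [ConnectedSpace X], ∀ D ∈ admissibleVacuumData X, ∀ (𝒟 : VacuumCauchyDevelopment D) (N : ℕ) (M a : Fin N → ℝ) (S : Set 𝒟.carrier) (p : 𝒟.carrier) (mo' : Fin N → lorentzGroup × E4) (B' : Fin N → ModelBackground) (Φ : ∀ i, (B' i).domain → 𝒟.carrier), 𝒟.IsMaximal → N ≤ N₀ → N ≤ 1 → (∀ i, m₀ ≤ M i ∧ M i ≤ m₀⁻¹ ∧ |a i| ≤ χ * M i) → IsNearKerrLeafBG 𝒟.toCauchyDevelopment k' Λ Λ₁ N M a S → p ∈ S → (N = 0 ∨ ∃ i, p ∈ Φ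 i '' (B' i).truncTimeSlab (3 * M i) 0) → (∀ i, B' i = starBackground (mo' i).1 (mo' i).2 (M i) (a i) (fun x => Kerr.radius (a i) (poincareInv (mo' i).1 (mo' i).2 x))) → (∀ i, ContMDiffOn 𝓘(ℝ, E4) (𝓡 4) ((⊤ : ℕ∞) : WithTop ℕ∞) (Φ i) {x | -1 < (B' i).time x.1 ∧ (B' i).time x.1 < 1 ∧ (B' i).radius x.1 < 3 * M i + 1} ∧ Topology.IsOpenEmbedding ({x | -1 < (B' i).time x.1 ∧ (B' i).time x.1 < 1 ∧ (B' i).radius x.1 < 3 * M i + 1}.restrict (Φ i))) → (∀ i, 𝒟.toSpacetime.truncDeviationCk (B' i) (Φ i) k' (3 * M i) 0 ≤ δ) → (∀ i, Φ i '' (B' i).truncTimeSlab (3 * M i) 0 ⊆ S) → Pairwise (Function.onFun Disjoint fun i => Φ i '' (B' i).truncTimeSlab (3 * M i) 0) → (∃ m : ℝ, 𝒟.toCauchyDevelopment.HasCutBondiMass ({p} ∪ ⋃ i, Φ i '' (B' i).truncTimeSlab (3 * M i) 0) m) → (∀ (X' : Type) [TopologicalSpace X'] [ChartedSpace E3 X']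 [IsManifold (𝓡 3) ((⊤ : ℕ∞) : WithTop ℕ∞) X'] [T2Space X'] [SecondCountableTopology X'] [ConnectedSpace X'], ∀ D' ∈ admissibleVacuumData X', ∀ (𝒟' : VacuumCauchyDevelopment D') (U : Set 𝒟.carrier) (φ : 𝒟.carrier → 𝒟'.carrier) (m' : ℝ), 𝒟'.IsMaximal → IsOpen U → ({p} ∪ ⋃ i, Φ i '' (B' i).truncTimeSlab (3 * M i) 0) ⊆ U → ContMDiffOn (𝓡 4) (𝓡 4) ((⊤ : ℕ∞) : WithTop ℕ∞) φ U → Topology.IsOpenEmbedding (U.restrict φ) → (∀ q ∈ U, pullbackBilin (I := 𝓡 4) (I' := 𝓡 4) φ 𝒟'.metric.val q = 𝒟.metric.val q) → (∀ q ∈ U, 𝒟'.timeOrientation.IsFutureDirected (mfderiv (𝓡 4) (𝓡 4) φ q (𝒟.timeOrientation.vectorField q))) → 𝒟'.toCauchyDevelopment.HasCutBondiMass (φ '' ({p} ∪ ⋃ i, Φ i '' (B' i).truncTimeSlab (3 * M i) 0)) m' → ∀ η : ℝ, 0 < η → ∃ m : ℝ, 𝒟.toCauchyDevelopment.HasCutBondiMass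 ({p} ∪ ⋃ i, Φ i '' (B' i).truncTimeSlab (3 * M i) 0) m ∧ m ≤ m' + γ + η) → ∃ S' : Set 𝒟.carrier, 𝒟.toCauchyDevelopment.IsNearKerrLeaf k ε N M a S' ∧ S' ⊆ 𝒟.metric.causalFuture 𝒟.timeOrientation S

end Summit.FinalStateConjecture.FinalStateConjecture.Cruxes.BondiBartnikRigidity

end
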